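import Summits.CriticalPhenomena.PercolationContinuityZ3.Theorems.PercNearOneGluingNoHeavyLowerTailSahiCTCRtThreeKleitmanBulk
import HarnessLib

/-!
# `NoHeavyLowerTail` (crux stmt-CriticalPhenomena-4575), P3 lane: LINEARITY, SPLITTING AND LOCALISATION OF THE WEIGHTED ATOM SUMS —
# the tools that reduce the all-`k` certificates of the rows of `R_3 ∈ ℕ[s]` to finite windows

Support file (seat `prim-l12-p3`, gen 50; `--supports stmt-CriticalPhenomena-4575`).  Memo
`run/shared/lean/prim/prim-l12/FROM-prim-l12-p3-g50-KLEITMAN-BULK.md` §6.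

The atom sum `atomSum wJ wX wOx wOz wOO 𝒳 𝒵 V` of `…SahiCTCRtThreeSepDefs` (single-step atoms inside `V` weighted by five tables of the type of the
top corner) is the language of the bulk (`…KleitmanBulk`) and of the bilinear part of the window certificates.  This file proves three structural facts:
* `atomΩ_add`, `atomSum_add` : the atom sum is ADDITIVE in the five tables (pointwise sums);
* `atomΩ_indicator`, `atomSum_split` : splitting the tables by a predicate of the type, e.g. `[a+b+c ≥ 5]` (the BULK, tops with at least five points)
  and `[a+b+c ≤ 4]` (the window part): `atomSum w = atomSum (w·[p]) + atomSum (w·[¬p])`;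
* `sum_atomSum_eq_atomSum_smul` (LOCALISATION): for any family `𝒬` of subsets of `V`, `Σ_{Q ∈ 𝒬} atomSum w 𝒳 𝒵 Q` is again an atom sum on `V`, each atom
  counted `#{Q ∈ 𝒬 : top corner ⊆ Q}` times (`sum_five_eq`: the exchange of the five sums); with `𝒬 = powersetCard n V` that multiplicity is
  `C(#V − (a+b+c), n − (a+b+c))` for a top of type `(a,b,c)` (`card_filter_powersetCard_union_subset`, from Mathlib's
  `card_filter_powersetCard_subset`) — `sum_powersetCard_atomSum`.  So an atom sum whose tables vanish unless `a+b+c ≤ 4` is `Σ` over the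
  4-subsets `Q` of `V` of atom sums ON `Q` with the tables divided by `C(#V−(a+b+c), 4−(a+b+c))` (`atomSum_window_eq_sum_powersetCard`): the window
  part of the squarefree row "lives on the 4-sets".
No new definitions; nothing is asserted about the crux.
-/

noncomputable section

open scoped Classical

namespace Summit.CriticalPhenomena.PercolationContinuityZ3.Theorems.SahiCTCForms

open Finset

variable {α : Type*} [DecidableEq α]

/-! ### Additivity in the tables -/

section Add
variable (wJ wX wOx wOz wOO wJ' wX' wOx' wOz' wOO' : ℕ → ℕ → ℕ → ℚ)

/-- The atom weight is additive in the five tables. [this work] -/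
theorem atomΩ_add (S : Finset α) (u : α) (S' : Finset α) (v : α) :
    atomΩ (fun a b c => wJ a b c + wJ' a b c) (fun a b c => wX a b c + wX' a b c) (fun a b c => wOx a b c + wOx' a b c)
        (fun a b c => wOz a b c + wOz' a b c) (fun a b c => wOO a b c + wOO' a b c) S u S' v =
      atomΩ wJ wX wOx wOz wOO S u S' v + atomΩ wJ' wX' wOx' wOz' wOO' S u S' v := by
  unfold atomΩ; split_ifs <;> rfl

/-- **The weighted atom sum is additive in the five tables.** [this work] -/
theorem atomSum_add (F G : Finset (Finset α)) (V : Finset α) :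
    atomSum (fun a b c => wJ a b c + wJ' a b c) (fun a b c => wX a b c + wX' a b c) (fun a b c => wOx a b c + wOx' a b c)
        (fun a b c => wOz a b c + wOz' a b c) (fun a b c => wOO a b c + wOO' a b c) F G V =
      atomSum wJ wX wOx wOz wOO F G V + atomSum wJ' wX' wOx' wOz' wOO' F G V := by
  unfold atomSum
  simp only [atomΩ_add, add_mul, sum_add_distrib]

end Add

/-! ### Multiplying the tables by a function of the type; splitting -/

section Indicator
variable (wJ wX wOx wOz wOO : ℕ → ℕ → ℕ → ℚ) (χ : ℕ → ℕ → ℕ → ℚ)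

/-- A common factor depending only on the type comes out of the atom weight. [this work] -/
theorem atomΩ_mul (S : Finset α) (u : α) (S' : Finset α) (v : α) :
    atomΩ (fun a b c => χ a b c * wJ a b c) (fun a b c => χ a b c * wX a b c) (fun a b c => χ a b c * wOx a b c)
        (fun a b c => χ a b c * wOz a b c) (fun a b c => χ a b c * wOO a b c) S u S' v =
      χ #(S ∩ S') #(S \ S') #(S' \ S) * atomΩ wJ wX wOx wOz wOO S u S' v := by
  unfold atomΩ; split_ifs <;> rfl

/-- **Splitting the atom sum by a predicate of the type**: `atomSum w = atomSum (w·[p]) + atomSum (w·[¬p])`. [this work] -/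
theorem atomSum_split (p : ℕ → ℕ → ℕ → Prop) (F G : Finset (Finset α)) (V : Finset α) :
    atomSum wJ wX wOx wOz wOO F G V =
      atomSum (fun a b c => if p a b c then wJ a b c else 0) (fun a b c => if p a b c then wX a b c else 0)
          (fun a b c => if p a b c then wOx a b c else 0) (fun a b c => if p a b c then wOz a b c else 0)
          (fun a b c => if p a b c then wOO a b c else 0) F G V
      + atomSum (fun a b c => if p a b c then 0 else wJ a b c) (fun a b c => if p a b c then 0 else wX a b c)
          (fun a b c => if p a b c then 0 else wOx a b c) (fun a b c => if p a b c then 0 else wOz a b c)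
          (fun a b c => if p a b c then 0 else wOO a b c) F G V := by
  rw [← atomSum_add]
  unfold atomSum
  refine sum_congr rfl fun A _ => sum_congr rfl fun u _ => sum_congr rfl fun B _ => sum_congr rfl fun v _ => ?_
  congr 1
  unfold atomΩ
  by_cases hp : p #(insert u A ∩ insert v B) #(insert u A \ insert v B) #(insert v B \ insert u A)
  · simp only [hp, if_true, add_zero]
  · simp only [hp, if_false, zero_add]

end Indicator

/-! ### Localisation: summing atom sums over a family of subsets -/

section Localise
variable (wJ wX wOx wOz wOO : ℕ → ℕ → ℕ → ℚ)

/-- Exchange of the five sums: `Σ_{Q ∈ 𝒬} Σ_{A ⊆ Q, u ∈ Q∖A, B ⊆ Q, v ∈ Q∖B} f = Σ_{A ⊆ V, u ∈ V∖A, B ⊆ V, v ∈ V∖B} #{Q ∈ 𝒬 : A+u ∪ B+v ⊆ Q}·f`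
for `𝒬 ⊆ 2^V`. [this work] -/
theorem sum_five_eq (𝒬 : Finset (Finset α)) (V : Finset α) (h𝒬 : ∀ Q ∈ 𝒬, Q ⊆ V) (f : Finset α → α → Finset α → α → ℚ) :
    ∑ Q ∈ 𝒬, ∑ A ∈ Q.powerset, ∑ u ∈ Q \ A, ∑ B ∈ Q.powerset, ∑ v ∈ Q \ B, f A u B v =
      ∑ A ∈ V.powerset, ∑ u ∈ V \ A, ∑ B ∈ V.powerset, ∑ v ∈ V \ B,
        (#(𝒬.filter fun Q => insert u A ∪ insert v B ⊆ Q) : ℚ) * f A u B v := by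
  -- step 1: inner sums over `V` with indicators
  have hstep : ∀ Q ∈ 𝒬, ∑ A ∈ Q.powerset, ∑ u ∈ Q \ A, ∑ B ∈ Q.powerset, ∑ v ∈ Q \ B, f A u B v =
      ∑ A ∈ V.powerset, ∑ u ∈ V \ A, ∑ B ∈ V.powerset, ∑ v ∈ V \ B,
        (if insert u A ∪ insert v B ⊆ Q then f A u B v else 0) := by
    intro Q hQ
    have hQV := h𝒬 Q hQ
    -- A
    rw [← sum_subset (powerset_mono.2 hQV) (fun A hA hAQ => ?_)]
    · refine sum_congr rfl fun A hA => ?_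
      have hAQ : A ⊆ Q := mem_powerset.1 hA
      -- u
      rw [← sum_subset (sdiff_subset_sdiff hQV Subset.rfl) (fun u hu huQ => ?_)]
      · refine sum_congr rfl fun u hu => ?_
        have huQ : u ∈ Q := (mem_sdiff.1 hu).1
        -- B
        rw [← sum_subset (powerset_mono.2 hQV) (fun B hB hBQ => ?_)]
        · refine sum_congr rfl fun B hB => ?_
          have hBQ : B ⊆ Q := mem_powerset.1 hB
          -- v
          rw [← sum_subset (sdiff_subset_sdiff hQV Subset.rfl) (fun v hv hvQ => ?_)]
          · refine sum_congr rfl fun v hv => ?_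
            have hvQ : v ∈ Q := (mem_sdiff.1 hv).1
            rw [if_pos (union_subset (insert_subset huQ hAQ) (insert_subset hvQ hBQ))]
          · have : v ∉ Q := fun h => hvQ (mem_sdiff.2 ⟨h, (mem_sdiff.1 hv).2⟩)
            rw [if_neg fun h => this (h (mem_union_right _ (mem_insert_self v B)))]
        · have : ¬ B ⊆ Q := fun h => hBQ (mem_powerset.2 h)
          refine sum_eq_zero fun v _ => ?_
          rw [if_neg fun h => this ((subset_insert v B).trans (subset_union_right.trans h))]
      · have : u ∉ Q := fun h => huQ (mem_sdiff.2 ⟨h, (mem_sdiff.1 hu).2⟩)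
        refine sum_eq_zero fun B _ => sum_eq_zero fun v _ => ?_
        rw [if_neg fun h => this (h (mem_union_left _ (mem_insert_self u A)))]
    · have : ¬ A ⊆ Q := fun h => hAQ (mem_powerset.2 h)
      refine sum_eq_zero fun u _ => sum_eq_zero fun B _ => sum_eq_zero fun v _ => ?_
      rw [if_neg fun h => this ((subset_insert u A).trans (subset_union_left.trans h))]
  rw [sum_congr rfl hstep]
  -- step 2: exchange `Σ_Q` with the four sums and evaluate `Σ_Q [⋯ ⊆ Q]`
  rw [sum_comm]
  refine sum_congr rfl fun A _ => ?_
  rw [sum_comm]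
  refine sum_congr rfl fun u _ => ?_
  rw [sum_comm]
  refine sum_congr rfl fun B _ => ?_
  rw [sum_comm]
  refine sum_congr rfl fun v _ => ?_
  rw [← sum_filter, sum_const, nsmul_eq_mul]

/-- The number of `n`-subsets of `V` containing `U ⊆ V` is `C(#V − #U, n − #U)` if `#U ≤ n` and `0` otherwise. [this work] -/
theorem card_filter_powersetCard_superset (V U : Finset α) (hU : U ⊆ V) (n : ℕ) :
    #((V.powersetCard n).filter fun Q => U ⊆ Q) = if #U ≤ n then (#V - #U).choose (n - #U) else 0 := by
  split_ifs with h
  · exact card_filter_powersetCard_subset U V n hU h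
  · refine card_eq_zero.2 (filter_eq_empty_iff.2 fun Q hQ hUQ => h ?_)
    rw [mem_powersetCard] at hQ
    rw [← hQ.2]; exact card_le_card hUQ

/-- The top corner `(A+u) ∪ (B+v)` has `a + b + c` points, `(a,b,c)` the type of `(A+u, B+v)`. [this work] -/
theorem card_union_eq_type (S S' : Finset α) : #(S ∪ S') = #(S ∩ S') + #(S \ S') + #(S' \ S) := by
  have h1 : #(S ∪ S') + #(S ∩ S') = #S + #S' := card_union_add_card_inter S S'
  have h2 : #(S ∩ S') + #(S \ S') = #S := card_inter_add_card_sdiff S S'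
  have h3 : #(S ∩ S') + #(S' \ S) = #S' := by rw [inter_comm]; exact card_inter_add_card_sdiff S' S
  omega

/-- **LOCALISATION**: for any `𝒬 ⊆ 2^V`, `Σ_{Q ∈ 𝒬} atomSum w 𝒳 𝒵 Q = Σ_atoms #{Q ∈ 𝒬 : top ⊆ Q}·Ω·Δx·Δz` on `V`. [this work] -/
theorem sum_atomSum_eq (𝒬 : Finset (Finset α)) (V : Finset α) (h𝒬 : ∀ Q ∈ 𝒬, Q ⊆ V) (F G : Finset (Finset α)) :
    ∑ Q ∈ 𝒬, atomSum wJ wX wOx wOz wOO F G Q =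
      ∑ A ∈ V.powerset, ∑ u ∈ V \ A, ∑ B ∈ V.powerset, ∑ v ∈ V \ B,
        (#(𝒬.filter fun Q => insert u A ∪ insert v B ⊆ Q) : ℚ) *
          (atomΩ wJ wX wOx wOz wOO (insert u A) u (insert v B) v * ((ιq F (insert u A) - ιq F A) * (ιq G (insert v B) - ιq G B))) := by
  unfold atomSum
  exact sum_five_eq 𝒬 V h𝒬 _

/-- **LOCALISATION ON THE `n`-SUBSETS**: `Σ_{Q ⊆ V, #Q = n} atomSum w 𝒳 𝒵 Q = atomSum (C(#V−(a+b+c), n−(a+b+c))·[a+b+c ≤ n]·w) 𝒳 𝒵 V`. [this work] -/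
theorem sum_powersetCard_atomSum (n : ℕ) (V : Finset α) (F G : Finset (Finset α)) :
    ∑ Q ∈ V.powersetCard n, atomSum wJ wX wOx wOz wOO F G Q =
      atomSum (fun a b c => (if a + b + c ≤ n then (((#V - (a + b + c)).choose (n - (a + b + c)) : ℕ) : ℚ) else 0) * wJ a b c)
        (fun a b c => (if a + b + c ≤ n then (((#V - (a + b + c)).choose (n - (a + b + c)) : ℕ) : ℚ) else 0) * wX a b c)
        (fun a b c => (if a + b + c ≤ n then (((#V - (a + b + c)).choose (n - (a + b + c)) : ℕ) : ℚ) else 0) * wOx a b c)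
        (fun a b c => (if a + b + c ≤ n then (((#V - (a + b + c)).choose (n - (a + b + c)) : ℕ) : ℚ) else 0) * wOz a b c)
        (fun a b c => (if a + b + c ≤ n then (((#V - (a + b + c)).choose (n - (a + b + c)) : ℕ) : ℚ) else 0) * wOO a b c) F G V := by
  rw [sum_atomSum_eq wJ wX wOx wOz wOO (V.powersetCard n) V (fun Q hQ => (mem_powersetCard.1 hQ).1) F G]
  unfold atomSum
  refine sum_congr rfl fun A hA => sum_congr rfl fun u hu => sum_congr rfl fun B hB => sum_congr rfl fun v hv => ?_
  rw [atomΩ_mul, ← mul_assoc]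
  congr 1
  have hsub : insert u A ∪ insert v B ⊆ V :=
    union_subset (insert_subset (mem_sdiff.1 hu).1 (mem_powerset.1 hA)) (insert_subset (mem_sdiff.1 hv).1 (mem_powerset.1 hB))
  rw [card_filter_powersetCard_superset V _ hsub n, card_union_eq_type]
  split_ifs <;> simp

/-- **THE WINDOW PART LIVES ON THE 4-SETS**: if the five tables vanish unless `a + b + c ≤ 4`, then for `#V ≥ 4`
`atomSum w 𝒳 𝒵 V = Σ_{Q ⊆ V, #Q = 4} atomSum (w / C(#V−(a+b+c), 4−(a+b+c))) 𝒳 𝒵 Q`. [this work] -/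
theorem atomSum_window_eq_sum_powersetCard (V : Finset α) (F G : Finset (Finset α))
    (hJ : ∀ a b c, 4 < a + b + c → wJ a b c = 0) (hX : ∀ a b c, 4 < a + b + c → wX a b c = 0)
    (hOx : ∀ a b c, 4 < a + b + c → wOx a b c = 0) (hOz : ∀ a b c, 4 < a + b + c → wOz a b c = 0)
    (hOO : ∀ a b c, 4 < a + b + c → wOO a b c = 0) (hV : 4 ≤ #V) :
    atomSum wJ wX wOx wOz wOO F G V =
      ∑ Q ∈ V.powersetCard 4, atomSum
        (fun a b c => wJ a b c / (((#V - (a + b + c)).choose (4 - (a + b + c)) : ℕ) : ℚ))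
        (fun a b c => wX a b c / (((#V - (a + b + c)).choose (4 - (a + b + c)) : ℕ) : ℚ))
        (fun a b c => wOx a b c / (((#V - (a + b + c)).choose (4 - (a + b + c)) : ℕ) : ℚ))
        (fun a b c => wOz a b c / (((#V - (a + b + c)).choose (4 - (a + b + c)) : ℕ) : ℚ))
        (fun a b c => wOO a b c / (((#V - (a + b + c)).choose (4 - (a + b + c)) : ℕ) : ℚ)) F G Q := by
  rw [sum_powersetCard_atomSum]
  unfold atomSum
  refine sum_congr rfl fun A _ => sum_congr rfl fun u _ => sum_congr rfl fun B _ => sum_congr rfl fun v _ => ?_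
  congr 1
  -- the tables agree at every type
  have key : ∀ (w : ℕ → ℕ → ℕ → ℚ), (∀ a b c, 4 < a + b + c → w a b c = 0) → ∀ a b c,
      (if a + b + c ≤ 4 then (((#V - (a + b + c)).choose (4 - (a + b + c)) : ℕ) : ℚ) else 0) *
        (w a b c / (((#V - (a + b + c)).choose (4 - (a + b + c)) : ℕ) : ℚ)) = w a b c := by
    intro w hw a b c
    by_cases h : a + b + c ≤ 4
    · rw [if_pos h]
      have hpos : 0 < (#V - (a + b + c)).choose (4 - (a + b + c)) := Nat.choose_pos (by omega)
      have hne : ((((#V - (a + b + c)).choose (4 - (a + b + c)) : ℕ) : ℚ)) ≠ 0 := by positivity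
      field_simp
    · rw [if_neg h, zero_mul, hw a b c (by omega)]
  unfold atomΩ
  split_ifs
  · exact (key wJ hJ _ _ _).symm
  · exact (key wX hX _ _ _).symm
  · exact (key wOx hOx _ _ _).symm
  · exact (key wOz hOz _ _ _).symm
  · exact (key wOO hOO _ _ _).symm

end Localise

end Summit.CriticalPhenomena.PercolationContinuityZ3.Theorems.SahiCTCForms
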